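import Mathlib.Combinatorics.SetFamily.FourFunctions
import Mathlib.Data.Finset.SymmDiff
import Mathlib.Tactic
import HarnessLib
import HarnessLib.Audit.Tags
import Summits.CriticalPhenomena.PercolationContinuityZ3.Theorems.PercNearOneGluingNoHeavyLowerTailSahiMSWitness
import Summits.CriticalPhenomena.PercolationContinuityZ3.Theorems.PercNearOneGluingNoHeavyLowerTailSahiMSSlices

/-!
# Equality in the Marica–Schönheim inequality, III: nested slices and common witnesses

Support file (seat `prim-masterthm-p1`, gen 29; `--supports stmt-CriticalPhenomena-4575`).  No `sorry`, no new definitions, standard axioms.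
Memo `run/shared/lean/prim/prim-masterthm/FROM-prim-masterthm-p1-g29-MS-EQUALITY.md`, Lemmas 3 and 5.

* `slices_nested` (Lemma 3): if `#(Q \\ Q) = #Q` and the common part `T = slice₀ ∩ slice₁` of the slices at `r` is non-empty and
  has a witness, then `slice₀ ⊆ slice₁` or `slice₁ ⊆ slice₀`.  Proof: the transfer lemma gives `slice₁ \\ slice₀ = T \\ T`, and the
  Ahlswede–Daykin inequality `#s₁·#s₀ ≤ #(s₁ \\ s₀)·#(s₀ \\ s₁)` (Mathlib `Finset.le_card_diffs_mul_card_diffs`) then forces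
  `(#s₀ − #T)(#s₁ − #T) ≤ 0`.
* `IsWitness.common_union` / `IsWitness.common_inter` (Lemma 5): for `S ⊆ B` with witnesses `M_S, M_B`: if `B \\ S ⊆ S \\ S` then
  `M_S ∪ M_B` witnesses both; if `S \\ B ⊆ S \\ S` then `M_S ∩ M_B` witnesses both. [this work]
-/

namespace Summit.CriticalPhenomena.PercolationContinuityZ3.Theorems.SahiMSEquality

open Finset
open scoped FinsetFamily symmDiff

variable {α : Type*} [DecidableEq α]

/-! ### 5. Nested slices (memo Lemma 3) -/

section Nested

variable {Q : Finset (Finset α)} {r : α}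

/-- **Nested slices.**  If `#(Q \\ Q) = #Q` and the common part `T = slice₀ ∩ slice₁` is non-empty and has a witness, then one slice
contains the other.  (Transfer lemma ⟹ `slice₁ \\ slice₀ = T \\ T`; then the Ahlswede–Daykin inequality
`#s₁ · #s₀ ≤ #(s₁ \\ s₀) · #(s₀ \\ s₁)` forces `(#s₀ − #T)(#s₁ − #T) ≤ 0`.) [this work] -/
theorem slices_nested (hQ : #(Q \\ Q) = #Q) (hT : (slice₀ Q r ∩ slice₁ Q r).Nonempty) {M : Finset α}
    (hW : IsWitness (slice₀ Q r ∩ slice₁ Q r) M) : slice₀ Q r ⊆ slice₁ Q r ∨ slice₁ Q r ⊆ slice₀ Q r := by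
  obtain ⟨_, hTe, hAB⟩ := slices_of_card_diffs_eq Q r hQ
  have hA := slice₀_diffs Q r
  have hB := slice₁_diffs Q r
  have h1 : #(Q \\ Q) = #(slice₀ (Q \\ Q) r) + #(slice₁ (Q \\ Q) r) := card_eq_card_slice₀_add_card_slice₁ _ r
  have h2 : #Q = #(slice₀ Q r) + #(slice₁ Q r) := card_eq_card_slice₀_add_card_slice₁ _ r
  have hAD := Finset.le_card_diffs_mul_card_diffs (slice₁ Q r) (slice₀ Q r)
  set s₀ := slice₀ Q r with hs₀
  set s₁ := slice₁ Q r with hs₁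
  set T := s₀ ∩ s₁ with hTdef
  set A := slice₀ (Q \\ Q) r with hAdef
  set B := slice₁ (Q \\ Q) r with hBdef
  -- (i) s₁ − T ⊆ T \\ T and (ii) T − s₀ ⊆ T \\ T
  have hi : ∀ h ∈ s₁, ∀ t ∈ T, h \ t ∈ T \\ T := by
    intro h hh t ht
    rw [← hAB]
    refine mem_inter.2 ⟨?_, ?_⟩
    · rw [hA]; exact mem_union.2 (Or.inr (sdiff_mem_diffs hh (mem_inter.1 ht).2))
    · rw [hB]; exact sdiff_mem_diffs hh (mem_inter.1 ht).1
  have hii : ∀ t ∈ T, ∀ l ∈ s₀, t \ l ∈ T \\ T := by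
    intro t ht l hl
    rw [← hAB]
    refine mem_inter.2 ⟨?_, ?_⟩
    · rw [hA]; exact mem_union.2 (Or.inl (sdiff_mem_diffs (mem_inter.1 ht).1 (mem_union.2 (Or.inl hl))))
    · rw [hB]; exact sdiff_mem_diffs (mem_inter.1 ht).2 hl
  -- (iii) transfer: s₁ \\ s₀ ⊆ T \\ T, hence B = T \\ T
  have hiii : B = T \\ T := by
    apply Subset.antisymm
    · rw [hB]
      intro X hX
      obtain ⟨h, hh, l, hl, rfl⟩ := mem_diffs.1 hX
      exact hW.sdiff_mem_diffs_of_forall hT (hi h hh) (fun t ht => hii t ht l hl)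
    · rw [← hAB]; exact inter_subset_right
  -- (iv) cardinalities
  have hcB : #B = #T := by rw [hiii, hTe]
  have hsub : s₀ \\ s₁ ⊆ A := by
    rw [hA]; exact (diffs_subset_left subset_union_right).trans subset_union_left
  have h3 : #(s₀ \\ s₁) ≤ #A := card_le_card hsub
  rw [← hB, hcB] at hAD
  have hT0 : #T ≤ #s₀ := card_le_card inter_subset_left
  have hT1 : #T ≤ #s₁ := card_le_card inter_subset_right
  have hmul : #s₁ * #s₀ ≤ #T * #A := hAD.trans (Nat.mul_le_mul_left _ h3)
  by_cases e0 : #T = #s₀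
  · left
    have : T = s₀ := eq_of_subset_of_card_le inter_subset_left e0.ge
    rw [← this]; exact inter_subset_right
  by_cases e1 : #T = #s₁
  · right
    have : T = s₁ := eq_of_subset_of_card_le inter_subset_right e1.ge
    rw [← this]; exact inter_subset_left
  exfalso
  have lt0 : #T < #s₀ := lt_of_le_of_ne hT0 e0
  have lt1 : #T < #s₁ := lt_of_le_of_ne hT1 e1
  have hA' : #A + #T = #s₀ + #s₁ := by omega
  nlinarith

end Nested

/-! ### 6. Common witnesses for nested families (memo Lemma 5) -/

namespace IsWitness

variable {S B : Finset (Finset α)} {MS MB : Finset α}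

/-- **Common witness, case (a).**  If `S ⊆ B` have witnesses `MS`, `MB` and every difference `b \ s` (`b ∈ B`, `s ∈ S`) is a difference
of `S`, then `MS ∪ MB` is a witness for both. [this work] -/
theorem common_union (hS : IsWitness S MS) (hBw : IsWitness B MB) (hSB : S ⊆ B) (hSne : S.Nonempty)
    (hK : B \\ S ⊆ S \\ S) : IsWitness S (MS ∪ MB) ∧ IsWitness B (MS ∪ MB) := by
  have hMS : MS ∈ S := hS.mem hSne
  have hMB : MB ∈ B := hBw.mem (hSne.mono hSB)
  -- (1) h ∪ MS ∈ S for all h ∈ B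
  have h1 : ∀ h ∈ B, h ∪ MS ∈ S := by
    intro h hh
    obtain ⟨c, hc, hce⟩ := hS.mem_diffs_iff.1 (hK (sdiff_mem_diffs hh hMS))
    have : c = (h \ MS) ∆ MS := by rw [← hce, symmDiff_symmDiff_cancel_right]
    have e : (h \ MS) ∆ MS = h ∪ MS := by
      ext x; simp only [mem_symmDiff, mem_sdiff, mem_union]; tauto
    rw [← e, ← this]; exact hc
  have hM' : MB ∪ MS ∈ S := h1 MB hMB
  constructor
  · -- witness for S: t ↦ t △ β ∈ S with β = MB \ MS, outer coordinates w.r.t. MS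
    refine isWitness_of_image_subset ?_ hS.card_diffs
    intro X hX
    obtain ⟨t, ht, rfl⟩ := mem_image.1 hX
    -- members with the needed outer parts
    have htB : t ∪ MB ∈ B := hBw.union_mem (hSB ht)
    have hbig : t ∪ MB ∪ MS ∈ S := h1 _ htB
    obtain ⟨u, hu, huD⟩ := hS.exists_sdiff_eq_inter ht hM'            -- u \ MS = (t \ MS) ∩ ((MB∪MS) \ MS)
    obtain ⟨z₂, hz₂, hz₂D⟩ := hS.exists_sdiff_eq_sdiff hbig hu       -- z₂ \ MS = (big \ MS) \ (u \ MS)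
    have hmem : t ∆ (MB \ MS) ∈ S := by
      refine hS.mem_of_parts ht hz₂ ?_ ?_
      · ext x; simp only [mem_inter, mem_symmDiff, mem_sdiff]; tauto
      · rw [hz₂D, huD]; ext x; simp only [mem_symmDiff, mem_sdiff, mem_union, mem_inter]; tauto
    have e : t ∆ (MS ∪ MB) = (t ∆ (MB \ MS)) ∆ MS := by
      ext x; simp only [mem_symmDiff, mem_sdiff, mem_union]; tauto
    rw [e]
    exact hS.symmDiff_mem_diffs hmem
  · -- witness for B: h ↦ h △ γ ∈ B with γ = MS \ MB, outer coordinates w.r.t. MB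
    refine isWitness_of_image_subset ?_ hBw.card_diffs
    intro X hX
    obtain ⟨h, hh, rfl⟩ := mem_image.1 hX
    have hMSB : MS ∈ B := hSB hMS
    have hbig : h ∪ MS ∈ B := hSB (h1 h hh)
    obtain ⟨u, hu, huD⟩ := hBw.exists_sdiff_eq_inter hh hMSB          -- u \ MB = (h \ MB) ∩ (MS \ MB)
    obtain ⟨z₂, hz₂, hz₂D⟩ := hBw.exists_sdiff_eq_sdiff hbig hu      -- z₂ \ MB = ((h ∪ MS) \ MB) \ (u \ MB)
    have hmem : h ∆ (MS \ MB) ∈ B := by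
      refine hBw.mem_of_parts hh hz₂ ?_ ?_
      · ext x; simp only [mem_inter, mem_symmDiff, mem_sdiff]; tauto
      · rw [hz₂D, huD]; ext x; simp only [mem_symmDiff, mem_sdiff, mem_union, mem_inter]; tauto
    have e : h ∆ (MS ∪ MB) = (h ∆ (MS \ MB)) ∆ MB := by
      ext x; simp only [mem_symmDiff, mem_sdiff, mem_union]; tauto
    rw [e]
    exact hBw.symmDiff_mem_diffs hmem

/-- **Common witness, case (b).**  If `S ⊆ B` have witnesses `MS`, `MB` and every difference `s \ b` (`s ∈ S`, `b ∈ B`) is a difference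
of `S`, then `MS ∩ MB` is a witness for both. [this work] -/
theorem common_inter (hS : IsWitness S MS) (hBw : IsWitness B MB) (hSB : S ⊆ B) (hSne : S.Nonempty)
    (hK : S \\ B ⊆ S \\ S) : IsWitness S (MS ∩ MB) ∧ IsWitness B (MS ∩ MB) := by
  have hMS : MS ∈ S := hS.mem hSne
  have hMB : MB ∈ B := hBw.mem (hSne.mono hSB)
  -- (1b) h ∩ MS ∈ S for all h ∈ B
  have h1 : ∀ h ∈ B, h ∩ MS ∈ S := by
    intro h hh
    obtain ⟨c, hc, hce⟩ := hS.mem_diffs_iff.1 (hK (sdiff_mem_diffs hMS hh))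
    have : c = (MS \ h) ∆ MS := by rw [← hce, symmDiff_symmDiff_cancel_right]
    have e : (MS \ h) ∆ MS = h ∩ MS := by
      ext x; simp only [mem_symmDiff, mem_sdiff, mem_inter]; tauto
    rw [← e, ← this]; exact hc
  have hM'' : MB ∩ MS ∈ S := h1 MB hMB
  constructor
  · -- witness for S: t ↦ t △ β' with β' = MS \ MB ⊆ MS (M-part changes, w.r.t. MS)
    refine isWitness_of_image_subset ?_ hS.card_diffs
    intro X hX
    obtain ⟨t, ht, rfl⟩ := mem_image.1 hX
    have htB : t ∩ MB ∈ B := hBw.inter_mem (hSB ht)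
    have hn₂ : t ∩ MB ∩ MS ∈ S := h1 _ htB
    obtain ⟨z, hz, hzU⟩ := hS.exists_inter_eq_union hM'' ht              -- z ∩ MS = (MB∩MS ∩ MS) ∪ (t ∩ MS)
    obtain ⟨z₁, hz₁, hz₁U⟩ := hS.exists_inter_eq_compl_sdiff hz hn₂     -- z₁ ∩ MS = (MS \ z) ∪ (n₂ ∩ MS)
    have hmem : t ∆ (MS \ MB) ∈ S := by
      refine hS.mem_of_parts hz₁ ht ?_ ?_
      · rw [hz₁U]
        ext x
        have hxz : x ∈ z ∩ MS ↔ x ∈ (MB ∩ MS ∩ MS) ∪ (t ∩ MS) := by rw [hzU]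
        simp only [mem_inter, mem_union] at hxz
        simp only [mem_inter, mem_symmDiff, mem_sdiff, mem_union]
        tauto
      · ext x; simp only [mem_symmDiff, mem_sdiff]; tauto
    have e : t ∆ (MS ∩ MB) = (t ∆ (MS \ MB)) ∆ MS := by
      ext x; simp only [mem_symmDiff, mem_sdiff, mem_inter]; tauto
    rw [e]
    exact hS.symmDiff_mem_diffs hmem
  · -- witness for B: h ↦ h △ γ' with γ' = MB \ MS ⊆ MB (M-part changes, w.r.t. MB)
    refine isWitness_of_image_subset ?_ hBw.card_diffs
    intro X hX
    obtain ⟨h, hh, rfl⟩ := mem_image.1 hX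
    have hm₁ : MB ∩ MS ∈ B := hSB hM''
    have hm₂ : h ∩ MS ∈ B := hSB (h1 h hh)
    obtain ⟨z, hz, hzU⟩ := hBw.exists_inter_eq_union hm₁ hh              -- z ∩ MB = (MB∩MS ∩ MB) ∪ (h ∩ MB)
    obtain ⟨z₁, hz₁, hz₁U⟩ := hBw.exists_inter_eq_compl_sdiff hz hm₂    -- z₁ ∩ MB = (MB \ z) ∪ (h ∩ MS ∩ MB)
    have hmem : h ∆ (MB \ MS) ∈ B := by
      refine hBw.mem_of_parts hz₁ hh ?_ ?_
      · rw [hz₁U]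
        ext x
        have hxz : x ∈ z ∩ MB ↔ x ∈ (MB ∩ MS ∩ MB) ∪ (h ∩ MB) := by rw [hzU]
        simp only [mem_inter, mem_union] at hxz
        simp only [mem_inter, mem_symmDiff, mem_sdiff, mem_union]
        tauto
      · ext x; simp only [mem_symmDiff, mem_sdiff]; tauto
    have e : h ∆ (MS ∩ MB) = (h ∆ (MB \ MS)) ∆ MB := by
      ext x; simp only [mem_symmDiff, mem_sdiff, mem_inter]; tauto
    rw [e]
    exact hBw.symmDiff_mem_diffs hmem

end IsWitness

end Summit.CriticalPhenomena.PercolationContinuityZ3.Theorems.SahiMSEquality
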